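import Literature.AlgebraicGeometry.HodgeTheory.CyclicReflectionEigenprojectors
import Mathlib.LinearAlgebra.Trace
import Mathlib.RingTheory.Polynomial.Cyclotomic.Roots
import Mathlib.RingTheory.Flat.Basic
import HarnessLib

/-!
# The eigenspaces `H(ζ^j)`, `j ≠ 0`, of a rational automorphism of prime order `p` all have the same
# dimension (Carlson–Toledo 1999 §2: `H^{n+1}(Y, ℂ)₀ = ⊕_{μ≠1} H(μ)` with the `H(μ)` Galois-conjugate; the
# irreducibility of the cyclotomic polynomial)

Family `hodge`, layer `Literature/AlgebraicGeometry/HodgeTheory`. THEOREMS; sequel of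
`CyclicReflectionEigenprojectors` (the eigen-projectors `π_j` of `τ ⊗ ℂ` for `τ : V →ₗ[ℚ] V`, `τ^p = 1`).
Written by the prover seat `hodge-nonav-prover-A` (cell `hodge-nonav`) for the crux K1
`VeryGeneralDeckCommutatorsInHg` (`stmt-HodgeConjecture-19544`), lane-D glue
`stub_unitaryCommutatorsInMon_of_facts`, hole S2 of prover-Ax's `LaneDGlueSkeleton-v9` ("all `E_i = H(ζ^{i+1})`
have the same dimension — Galois; and the `dim ≤ 1` branch"): the Goursat–Kolchin–Ribet step needs
`dim H(ζ^j) ≥ 2` for EVERY `j ≠ 0` as soon as it holds for one, and when the eigenspaces are lines the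
`τ`-commuting automorphisms commute outright.

The dimension count (no Galois theory beyond the irreducibility of `Φ_p` over `ℚ`, Mathlib
`Polynomial.cyclotomic_eq_minpoly_rat`): `m_j := dim_ℂ H(ζ^j) = tr π_j = (1/p) Σ_{i<p} ζ^{-ij} t_i` with the
RATIONAL numbers `t_i = tr(τ^i)` (`LinearMap.IsProj.trace`, `LinearMap.trace_baseChange`). For `j = p − 1`
this reads `p m_{p−1} − t_0 = Σ_{i=1}^{p−1} t_i ζ^i ∈ ℚ`; since `1, ζ, …, ζ^{p−2}` are linearly independent
over `ℚ` (`linearIndependent_pow`, `deg Φ_p = p − 1`) and `Σ_{i<p} ζ^i = 0`, all `t_i`, `1 ≤ i ≤ p − 1`, are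
EQUAL (to `t_0 − p m_{p−1}`); feeding this back, `p m_j = t_0 + (p m_{p−1} − t_0)` for every `1 ≤ j ≤ p−1`.

## What is proved (`V` a finite-dimensional `ℚ`-space, `τ : V →ₗ[ℚ] V`, `τ^p = 1`, `p` prime, `ζ` a primitive
## `p`-th root of unity in `ℂ`)
* `finrank_eigenspace_baseChange_eq_sum_trace` — `p · dim_ℂ H(ζ^j) = Σ_{i<p} ζ^{-ij} tr(τ^i)`.
* `trace_pow_eq_of_pow_prime` — `tr(τ^i) = tr(τ)` for `1 ≤ i ≤ p − 1`.
* **`finrank_eigenspace_baseChange_eq_of_pow_prime`** — `dim_ℂ H(ζ^j) = dim_ℂ H(ζ^{j'})` for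
  `1 ≤ j, j' ≤ p − 1`.
* `finrank_eigenspace_baseChange_one_eq` — `dim_ℂ H(1) = dim_ℚ V^τ` (the rational projector `π_0`).
* **`commute_of_finrank_eigenspace_le_one`** — if `dim_ℚ V^τ ≤ 1` and some (equivalently every) `H(ζ^j)`,
  `j ≠ 0`, has dimension `≤ 1`, then any two `τ`-commuting endomorphisms `g, h` of `V` commute
  (`g h = h g`): they preserve every `H(ζ^j)` and act there by scalars, and `Σ_j π_j = 1`.

## References
* [CarlsonToledo1999] J. A. Carlson, D. Toledo, *Discriminant complements and kernels of monodromy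
  representations*, Duke Math. J. 97 (1999), §2 (p. 5: the eigenspace decomposition `⊕ H(μ)` of the
  complexified primitive cohomology of a cyclic cover and its Galois symmetry).
* [Washington1997] L. C. Washington, *Introduction to Cyclotomic Fields*, 2nd ed., GTM 83 (1997), Ch. 2
  (irreducibility of `Φ_p`, `[ℚ(ζ_p) : ℚ] = p − 1`).
-/

noncomputable section

open Module Literature.AlgebraicGeometry.Motives
open scoped TensorProduct

namespace Literature.AlgebraicGeometry.HodgeTheory

universe v

variable {V : Type v} [AddCommGroup V] [Module ℚ V] [Module.Finite ℚ V]

/-! ### §1 `p · dim H(ζ^j) = Σ_i ζ^{-ij} tr(τ^i)` -/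

/-- **`dim_ℂ H(ζ^j) = tr π_j`**, i.e. `p · dim_ℂ H(ζ^j) = Σ_{i<p} ζ^{-ij} tr(τ^i)` with RATIONAL traces
`tr(τ^i)`: `π_j` is a projector onto `H(ζ^j)` (`cyclicEigenProjector_mem_eigenspace`,
`cyclicEigenProjector_apply_of_mem_eigenspace_self`, `LinearMap.IsProj.trace`) and
`tr((τ ⊗ ℂ)^i) = tr(τ^i)` (`LinearMap.trace_baseChange`). [cite: CarlsonToledo1999, §2 (p. 5)] -/
theorem finrank_eigenspace_baseChange_eq_sum_trace {τ : V →ₗ[ℚ] V} {p : ℕ} (hp : 0 < p) (hτ : τ ^ p = 1)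
    {ζ : ℂ} (hζ : IsPrimitiveRoot ζ p) (j : ℕ) :
    (p : ℂ) * (finrank ℂ (Module.End.eigenspace (τ.baseChange ℂ) (ζ ^ j)) : ℂ) =
      ∑ i ∈ Finset.range p, (ζ⁻¹) ^ (i * j) * algebraMap ℚ ℂ (LinearMap.trace ℚ V (τ ^ i)) := by
  have hζ0 : ζ ≠ 0 := hζ.ne_zero hp.ne'
  have hproj : LinearMap.IsProj (Module.End.eigenspace (τ.baseChange ℂ) (ζ ^ j)) (cyclicEigenProjector τ p ζ j) :=
    ⟨fun x => cyclicEigenProjector_mem_eigenspace hτ hζ.pow_eq_one hζ0 j x,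
      fun x hx => cyclicEigenProjector_apply_of_mem_eigenspace_self hp.ne' hζ0 j hx⟩
  rw [← hproj.trace, cyclicEigenProjector, map_smul, map_sum, smul_eq_mul, ← mul_assoc,
    mul_inv_cancel₀ (Nat.cast_ne_zero.2 hp.ne' : (p : ℂ) ≠ 0), one_mul]
  refine Finset.sum_congr rfl fun i _ => ?_
  rw [map_smul, smul_eq_mul, ← LinearMap.baseChange_pow, LinearMap.trace_baseChange]

/-! ### §2 Linear independence of `1, ζ, …, ζ^{p-2}` over `ℚ` -/

/-- **`1, ζ, …, ζ^{p−2}` are linearly independent over `ℚ`** (`Φ_p` is the minimal polynomial of `ζ`, of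
degree `p − 1`): a vanishing `ℚ`-combination `Σ_{i<p−1} cᵢ ζ^i = 0` has all `cᵢ = 0`.
[cite: Washington1997, Ch. 2] -/
theorem eq_zero_of_sum_ratCast_mul_pow_eq_zero {p : ℕ} (hp : p.Prime) {ζ : ℂ} (hζ : IsPrimitiveRoot ζ p)
    (c : ℕ → ℚ) (h : ∑ i ∈ Finset.range (p - 1), (c i : ℂ) * ζ ^ i = 0) : ∀ i, i < p - 1 → c i = 0 := by
  have hdeg : (minpoly ℚ ζ).natDegree = p - 1 := by
    rw [← Polynomial.cyclotomic_eq_minpoly_rat hζ hp.pos, Polynomial.natDegree_cyclotomic, Nat.totient_prime hp]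
  have hli := Fintype.linearIndependent_iff.mp (linearIndependent_pow (K := ℚ) ζ)
    (fun k : Fin (minpoly ℚ ζ).natDegree => c k) ?_
  · intro i hi
    have h := hli ⟨i, by rw [hdeg]; exact hi⟩
    exact h
  · rw [← hdeg] at h
    rw [← h, ← Fin.sum_univ_eq_sum_range (fun i => (c i : ℂ) * ζ ^ i)]
    refine Finset.sum_congr rfl fun k _ => ?_
    rw [Algebra.smul_def, eq_ratCast]

/-! ### §3 Equality of the dimensions `dim H(ζ^j)`, `j ≠ 0` -/

/-- A geometric sum of a non-trivial `p`-th root of unity vanishes. [folklore] -/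
private theorem geom_sum_eq_zero_of_pow_eq_one {ω : ℂ} {p : ℕ} (hω : ω ^ p = 1) (hω1 : ω ≠ 1) :
    ∑ i ∈ Finset.range p, ω ^ i = 0 := by
  rw [geom_sum_eq hω1, hω, sub_self, zero_div]

/-- **`tr(τ^i) = tr(τ)` for `1 ≤ i ≤ p − 1`** (`τ^p = 1`, `p` prime): from `p · dim H(ζ^{p−1}) − tr(τ⁰) =
Σ_{i=1}^{p−1} tr(τ^i) ζ^i ∈ ℚ`, the linear independence of `1, …, ζ^{p−2}` and `Σ_{i<p} ζ^i = 0`, all the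
`tr(τ^i)`, `1 ≤ i ≤ p−1`, coincide. [cite: CarlsonToledo1999, §2 (p. 5)] -/
theorem trace_pow_eq_of_pow_prime {τ : V →ₗ[ℚ] V} {p : ℕ} (hp : p.Prime) (hτ : τ ^ p = 1) {i : ℕ} (hi : 1 ≤ i)
    (hip : i < p) : LinearMap.trace ℚ V (τ ^ i) = LinearMap.trace ℚ V τ := by
  have hp0 : 0 < p := hp.pos
  obtain ⟨ζ, hζ⟩ : ∃ ζ : ℂ, IsPrimitiveRoot ζ p := ⟨_, Complex.isPrimitiveRoot_exp p hp.ne_zero⟩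
  have hζ0 : ζ ≠ 0 := hζ.ne_zero hp0.ne'
  have hpn : p = (p - 1) + 1 := (Nat.sub_add_cancel hp.one_le).symm
  set t : ℕ → ℚ := fun k => LinearMap.trace ℚ V (τ ^ k) with ht
  set m : ℕ := finrank ℂ (Module.End.eigenspace (τ.baseChange ℂ) (ζ ^ (p - 1))) with hm
  -- `p · m = Σ_{k<p} t_k ζ^k` (the `j = p − 1` instance: `ζ^{-k(p-1)} = ζ^k`)
  have hE : (p : ℂ) * (m : ℂ) = ∑ k ∈ Finset.range p, ((t k : ℚ) : ℂ) * ζ ^ k := by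
    rw [hm, finrank_eigenspace_baseChange_eq_sum_trace hp0 hτ hζ (p - 1)]
    refine Finset.sum_congr rfl fun k _ => ?_
    rw [eq_ratCast, mul_comm]
    congr 1
    have hk : ζ ^ (k * (p - 1)) * ζ ^ k = 1 := by
      have hexp : k * (p - 1) + k = p * k := by
        conv_rhs => rw [hpn]
        ring
      rw [← pow_add, hexp, pow_mul, hζ.pow_eq_one, one_pow]
    rw [inv_pow, ← (mul_eq_one_iff_inv_eq₀ (pow_ne_zero _ hζ0)).mp hk]
  -- the rational number `q = p m − t 0` and the relation `Σ_{k<p-1} (t (k+1) + q) ζ^k = 0`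
  set q : ℚ := (p : ℚ) * m - t 0 with hq
  have hsumζ : ∑ k ∈ Finset.range p, ζ ^ k = 0 :=
    geom_sum_eq_zero_of_pow_eq_one hζ.pow_eq_one (hζ.ne_one hp.one_lt)
  have hrel : ∑ k ∈ Finset.range (p - 1), ((t (k + 1) + q : ℚ) : ℂ) * ζ ^ k = 0 := by
    -- `Σ_{k<p-1} (t(k+1) + q) ζ^(k+1) = (p m − t 0) + q · (−1) = 0`, then divide by `ζ ≠ 0`
    have h2 : ∑ k ∈ Finset.range (p - 1), ((t (k + 1) : ℚ) : ℂ) * ζ ^ (k + 1) = (p : ℂ) * m - (t 0 : ℂ) := by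
      have h3 := hE
      conv_rhs at h3 => rw [hpn, Finset.sum_range_succ', pow_zero, mul_one]
      rw [h3]
      ring
    have h5 : ∑ k ∈ Finset.range (p - 1), ζ ^ (k + 1) = -1 := by
      have h6 := hsumζ
      conv_lhs at h6 => rw [hpn, Finset.sum_range_succ', pow_zero]
      linear_combination h6
    have h4 : ∑ k ∈ Finset.range (p - 1), ((q : ℚ) : ℂ) * ζ ^ (k + 1) = -(q : ℂ) := by
      rw [← Finset.mul_sum, h5, mul_neg, mul_one]
    have hsplit : ∑ k ∈ Finset.range (p - 1), ((t (k + 1) + q : ℚ) : ℂ) * ζ ^ (k + 1) =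
        ∑ k ∈ Finset.range (p - 1), ((t (k + 1) : ℚ) : ℂ) * ζ ^ (k + 1) +
          ∑ k ∈ Finset.range (p - 1), ((q : ℚ) : ℂ) * ζ ^ (k + 1) := by
      rw [← Finset.sum_add_distrib]
      refine Finset.sum_congr rfl fun k _ => ?_
      push_cast
      ring
    have h1 : ∑ k ∈ Finset.range (p - 1), ((t (k + 1) + q : ℚ) : ℂ) * ζ ^ (k + 1) = 0 := by
      rw [hsplit, h2, h4, hq]
      push_cast
      ring
    have h7 : ∑ k ∈ Finset.range (p - 1), ((t (k + 1) + q : ℚ) : ℂ) * ζ ^ (k + 1) =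
        ζ * ∑ k ∈ Finset.range (p - 1), ((t (k + 1) + q : ℚ) : ℂ) * ζ ^ k := by
      rw [Finset.mul_sum]
      refine Finset.sum_congr rfl fun k _ => ?_
      ring
    rw [h7] at h1
    exact (mul_eq_zero.1 h1).resolve_left hζ0
  have hall : ∀ k, k < p - 1 → t (k + 1) + q = 0 := eq_zero_of_sum_ratCast_mul_pow_eq_zero hp hζ _ hrel
  -- conclude: `t i = -q = t 1`
  have hi' : t i = -q := by
    have h := hall (i - 1) (by omega)
    rw [Nat.sub_add_cancel hi] at h
    linear_combination h
  have h1' : t 1 = -q := by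
    have h := hall 0 (by omega)
    linear_combination h
  change t i = LinearMap.trace ℚ V τ
  rw [hi', ← h1', ht]
  simp

/-- **All the eigenspaces `H(ζ^j)`, `1 ≤ j ≤ p − 1`, have the same dimension** (`τ^p = 1`, `p` prime,
`ζ` primitive): `p · dim H(ζ^j) = tr(1) − tr(τ)·1 + … ` is independent of `j` by `trace_pow_eq_of_pow_prime`
and `Σ_{i<p} ζ^{-ij} = 0`. (Equivalently: `V₀ = ker Φ_p(τ)` is a `ℚ(ζ_p)`-vector space and
`V₀ ⊗ ℂ = ⊕_{j≠0} H(ζ^j)` with `dim H(ζ^j) = dim_{ℚ(ζ)} V₀`; Carlson–Toledo's `H(μ)` are Galois conjugate.)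
[cite: CarlsonToledo1999, §2 (p. 5)] -/
theorem finrank_eigenspace_baseChange_eq_of_pow_prime {τ : V →ₗ[ℚ] V} {p : ℕ} (hp : p.Prime) (hτ : τ ^ p = 1)
    {ζ : ℂ} (hζ : IsPrimitiveRoot ζ p) {j j' : ℕ} (hj : 1 ≤ j) (hjp : j < p) (hj' : 1 ≤ j') (hj'p : j' < p) :
    finrank ℂ (Module.End.eigenspace (τ.baseChange ℂ) (ζ ^ j)) =
      finrank ℂ (Module.End.eigenspace (τ.baseChange ℂ) (ζ ^ j')) := by
  have hp0 : 0 < p := hp.pos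
  have hζ0 : ζ ≠ 0 := hζ.ne_zero hp0.ne'
  have hpn : p = (p - 1) + 1 := (Nat.sub_add_cancel hp.one_le).symm
  -- `p · dim H(ζ^j) = tr(τ⁰) − tr(τ)` for every `1 ≤ j < p`
  have key : ∀ {j : ℕ}, 1 ≤ j → j < p →
      (p : ℂ) * (finrank ℂ (Module.End.eigenspace (τ.baseChange ℂ) (ζ ^ j)) : ℂ) =
        algebraMap ℚ ℂ (LinearMap.trace ℚ V (τ ^ 0)) - algebraMap ℚ ℂ (LinearMap.trace ℚ V τ) := by
    intro j hj hjp
    rw [finrank_eigenspace_baseChange_eq_sum_trace hp0 hτ hζ j]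
    conv_lhs => rw [hpn, Finset.sum_range_succ', zero_mul, pow_zero, one_mul, add_comm]
    rw [sub_eq_add_neg]
    congr 1
    have ht : ∀ i ∈ Finset.range (p - 1), (ζ⁻¹) ^ ((i + 1) * j) * algebraMap ℚ ℂ (LinearMap.trace ℚ V (τ ^ (i + 1))) =
        ((ζ⁻¹) ^ j) ^ (i + 1) * algebraMap ℚ ℂ (LinearMap.trace ℚ V τ) := by
      intro i hi
      rw [trace_pow_eq_of_pow_prime hp hτ (Nat.le_add_left 1 i) (by have := Finset.mem_range.1 hi; omega),
        ← pow_mul, mul_comm j]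
    rw [Finset.sum_congr rfl ht, ← Finset.sum_mul]
    -- `Σ_{i<p-1} ω^(i+1) = -1` for `ω = ζ^{-j}`
    set ω : ℂ := (ζ⁻¹) ^ j with hω
    have hωp : ω ^ p = 1 := by rw [hω, ← pow_mul, mul_comm, pow_mul, inv_pow, hζ.pow_eq_one, inv_one, one_pow]
    have hω1 : ω ≠ 1 := by
      intro h1
      have h2 : ζ ^ j = 1 := by
        have h3 := congrArg (fun z => z⁻¹) h1
        simpa [hω, inv_pow] using h3
      exact hζ.pow_ne_one_of_pos_of_lt (by omega) hjp h2
    have hs : ∑ i ∈ Finset.range (p - 1), ω ^ (i + 1) = -1 := by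
      have h6 := geom_sum_eq_zero_of_pow_eq_one hωp hω1
      conv_lhs at h6 => rw [hpn, Finset.sum_range_succ', pow_zero]
      linear_combination h6
    rw [hs]
    ring
  have h := (key hj hjp).trans (key hj' hj'p).symm
  exact_mod_cast (mul_right_injective₀ (Nat.cast_ne_zero.2 hp0.ne' : (p : ℂ) ≠ 0) h)

/-! ### §4 `dim_ℂ H(1) = dim_ℚ V^τ` and the case of lines -/

omit [Module.Finite ℚ V] in
/-- The rational averaging projector `(1/p) Σ_{i<p} τ^i` onto `V^τ = ker(τ − 1)`. [folklore] -/
private theorem isProj_average {τ : V →ₗ[ℚ] V} {p : ℕ} (hp : 0 < p) (hτ : τ ^ p = 1) :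
    LinearMap.IsProj (Module.End.eigenspace τ 1) ((p : ℚ)⁻¹ • ∑ i ∈ Finset.range p, τ ^ i) := by
  have hpq : (p : ℚ) ≠ 0 := Nat.cast_ne_zero.2 hp.ne'
  refine ⟨fun x => ?_, fun x hx => ?_⟩
  · rw [Module.End.mem_eigenspace_iff, one_smul, LinearMap.smul_apply, map_smul]
    congr 1
    rw [LinearMap.sum_apply, map_sum]
    -- `τ (Σ τ^i x) = Σ τ^(i+1) x = Σ τ^i x` (shift, `τ^p = τ^0`)
    have h : ∀ i, τ ((τ ^ i) x) = (τ ^ (i + 1)) x := fun i => by rw [pow_succ', Module.End.mul_apply]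
    simp_rw [h]
    obtain ⟨n, hn⟩ : ∃ n, p = n + 1 := ⟨p - 1, (Nat.sub_add_cancel hp).symm⟩
    rw [hn, Finset.sum_range_succ, Finset.sum_range_succ' (fun i => (τ ^ i) x), ← hn, hτ, pow_zero]
  · rw [Module.End.mem_eigenspace_iff, one_smul] at hx
    have h : ∀ i, (τ ^ i) x = x := fun i => by
      induction i with
      | zero => rw [pow_zero, Module.End.one_apply]
      | succ i ih => rw [pow_succ, Module.End.mul_apply, hx, ih]
    rw [LinearMap.smul_apply, LinearMap.sum_apply]
    simp_rw [h]
    rw [Finset.sum_const, Finset.card_range, ← Nat.cast_smul_eq_nsmul ℚ, smul_smul, inv_mul_cancel₀ hpq, one_smul]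

/-- **`dim_ℂ H(1) = dim_ℚ V^τ`**: the complex `1`-eigenspace of `τ ⊗ ℂ` has the dimension of the rational
fixed space (both are traces of the averaging projector `(1/p) Σ τ^i`, over `ℚ` and over `ℂ`).
[cite: CarlsonToledo1999, §2 (p. 5)] -/
theorem finrank_eigenspace_baseChange_one_eq {τ : V →ₗ[ℚ] V} {p : ℕ} (hp : 0 < p) (hτ : τ ^ p = 1) :
    finrank ℂ (Module.End.eigenspace (τ.baseChange ℂ) 1) = finrank ℚ (Module.End.eigenspace τ 1) := by
  obtain ⟨ζ, hζ⟩ : ∃ ζ : ℂ, IsPrimitiveRoot ζ p := ⟨_, Complex.isPrimitiveRoot_exp p hp.ne'⟩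
  have hC := finrank_eigenspace_baseChange_eq_sum_trace hp hτ hζ 0
  rw [pow_zero] at hC
  simp only [mul_zero, pow_zero, one_mul] at hC
  have hQ : (p : ℚ) * (finrank ℚ (Module.End.eigenspace τ 1) : ℚ) = ∑ i ∈ Finset.range p, LinearMap.trace ℚ V (τ ^ i) := by
    rw [← (isProj_average hp hτ).trace, map_smul, map_sum, smul_eq_mul, ← mul_assoc,
      mul_inv_cancel₀ (Nat.cast_ne_zero.2 hp.ne' : (p : ℚ) ≠ 0), one_mul]
  have h : (p : ℂ) * (finrank ℂ (Module.End.eigenspace (τ.baseChange ℂ) 1) : ℂ) =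
      (p : ℂ) * (finrank ℚ (Module.End.eigenspace τ 1) : ℂ) := by
    rw [hC]
    have h2 := congrArg (algebraMap ℚ ℂ) hQ
    rw [map_mul, map_natCast, map_natCast, map_sum] at h2
    rw [h2]
  exact_mod_cast (mul_right_injective₀ (Nat.cast_ne_zero.2 hp.ne' : (p : ℂ) ≠ 0) h)

omit [Module.Finite ℚ V] in
/-- An endomorphism preserving a subspace of dimension `≤ 1` acts on it by a scalar. [folklore] -/
private theorem exists_smul_of_finrank_le_one {W : Submodule ℂ (ℂ ⊗[ℚ] V)} [FiniteDimensional ℂ W]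
    (hW : finrank ℂ W ≤ 1) {f : ℂ ⊗[ℚ] V →ₗ[ℂ] ℂ ⊗[ℚ] V} (hf : ∀ x ∈ W, f x ∈ W) :
    ∃ a : ℂ, ∀ x ∈ W, f x = a • x := by
  obtain ⟨v, hv⟩ := finrank_le_one_iff.mp hW
  by_cases hv0 : (v : ℂ ⊗[ℚ] V) = 0
  · refine ⟨0, fun x hx => ?_⟩
    obtain ⟨c, hc⟩ := hv ⟨x, hx⟩
    have hx0 : x = 0 := by
      have h := congrArg Subtype.val hc
      simp only [SetLike.val_smul, hv0, smul_zero] at h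
      exact h.symm
    rw [hx0, map_zero, smul_zero]
  · obtain ⟨a, ha⟩ := hv ⟨f v, hf v v.2⟩
    refine ⟨a, fun x hx => ?_⟩
    obtain ⟨c, hc⟩ := hv ⟨x, hx⟩
    have hx : x = c • (v : ℂ ⊗[ℚ] V) := by
      have h := congrArg Subtype.val hc
      simpa using h.symm
    have hfv : f v = a • (v : ℂ ⊗[ℚ] V) := by
      have h := congrArg Subtype.val ha
      simpa using h.symm
    rw [hx, map_smul, hfv, smul_comm]

omit [Module.Finite ℚ V] in
/-- `v ↦ 1 ⊗ v : V → ℂ ⊗_ℚ V` is injective (`ℚ → ℂ` is injective and `V` is flat over the field `ℚ`).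
[folklore] -/
private theorem tmul_one_injective : Function.Injective fun v : V => (1 : ℂ) ⊗ₜ[ℚ] v := by
  have h := (Module.Flat.rTensor_preserves_injective_linearMap (M := V) (Algebra.linearMap ℚ ℂ)
    (algebraMap ℚ ℂ).injective).comp (TensorProduct.lid ℚ V).symm.injective
  convert h using 1
  ext v
  simp

/-- **The case of lines**: if `V^τ` has dimension `≤ 1` and ONE eigenspace `H(ζ^{j₀})`, `1 ≤ j₀ ≤ p−1`, of
`τ ⊗ ℂ` has dimension `≤ 1` (hence all of them, `finrank_eigenspace_baseChange_eq_of_pow_prime`), then any two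
endomorphisms `g, h` of `V` commuting with `τ` commute: `g ⊗ ℂ`, `h ⊗ ℂ` preserve each `H(ζ^j)` and act there
by scalars, and `Σ_j π_j = id`. (Used for the degenerate branch of the Goursat–Kolchin–Ribet assembly: then
every commutator of the `τ`-unitary group is trivial.) [cite: CarlsonToledo1999, §2 (p. 5)] -/
theorem commute_of_finrank_eigenspace_le_one {τ : V →ₗ[ℚ] V} {p : ℕ} (hp : p.Prime) (hτ : τ ^ p = 1)
    {ζ : ℂ} (hζ : IsPrimitiveRoot ζ p) (hfix : finrank ℚ (Module.End.eigenspace τ 1) ≤ 1) {j₀ : ℕ}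
    (hj₀ : 1 ≤ j₀) (hj₀p : j₀ < p) (hsmall : finrank ℂ (Module.End.eigenspace (τ.baseChange ℂ) (ζ ^ j₀)) ≤ 1)
    {g h : V →ₗ[ℚ] V} (hg : g ∘ₗ τ = τ ∘ₗ g) (hh : h ∘ₗ τ = τ ∘ₗ h) : g ∘ₗ h = h ∘ₗ g := by
  have hp0 : 0 < p := hp.pos
  have hζ0 : ζ ≠ 0 := hζ.ne_zero hp0.ne'
  -- every eigenspace `H(ζ^j)`, `j < p`, has dimension `≤ 1`
  have hdim : ∀ j, j < p → finrank ℂ (Module.End.eigenspace (τ.baseChange ℂ) (ζ ^ j)) ≤ 1 := by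
    intro j hjp
    rcases Nat.eq_zero_or_pos j with rfl | hj
    · rw [pow_zero, finrank_eigenspace_baseChange_one_eq hp0 hτ]
      exact hfix
    · rw [finrank_eigenspace_baseChange_eq_of_pow_prime hp hτ hζ hj hjp hj₀ hj₀p]
      exact hsmall
  -- complexified maps commute with `τ ⊗ ℂ`, hence preserve the eigenspaces
  have hcomm : ∀ {f : V →ₗ[ℚ] V}, f ∘ₗ τ = τ ∘ₗ f →
      f.baseChange ℂ ∘ₗ τ.baseChange ℂ = τ.baseChange ℂ ∘ₗ f.baseChange ℂ := by
    intro f hf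
    rw [← LinearMap.baseChange_comp, ← LinearMap.baseChange_comp, hf]
  have hstab : ∀ {f : V →ₗ[ℚ] V}, f ∘ₗ τ = τ ∘ₗ f → ∀ (j : ℕ),
      ∀ x ∈ Module.End.eigenspace (τ.baseChange ℂ) (ζ ^ j), f.baseChange ℂ x ∈ Module.End.eigenspace (τ.baseChange ℂ) (ζ ^ j) := by
    intro f hf j x hx
    rw [Module.End.mem_eigenspace_iff] at hx ⊢
    have h := congrArg (fun u => u x) (hcomm hf)
    simp only [LinearMap.coe_comp, Function.comp_apply] at h
    rw [← h, hx, map_smul]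
  -- on each eigenspace both act by scalars, so they commute there
  have hE : ∀ (j : ℕ), j < p → ∀ x ∈ Module.End.eigenspace (τ.baseChange ℂ) (ζ ^ j),
      g.baseChange ℂ (h.baseChange ℂ x) = h.baseChange ℂ (g.baseChange ℂ x) := by
    intro j hjp x hx
    obtain ⟨a, ha⟩ := exists_smul_of_finrank_le_one (hdim j hjp) (hstab hg j)
    obtain ⟨b, hb⟩ := exists_smul_of_finrank_le_one (hdim j hjp) (hstab hh j)
    rw [hb x hx, map_smul, ha x hx, map_smul, hb x hx, smul_comm]
  -- assemble with `Σ_j π_j = id`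
  have hC : g.baseChange ℂ ∘ₗ h.baseChange ℂ = h.baseChange ℂ ∘ₗ g.baseChange ℂ := by
    refine LinearMap.ext fun x => ?_
    rw [LinearMap.comp_apply, LinearMap.comp_apply, ← sum_cyclicEigenProjector (τ := τ) hζ hp0 x, map_sum, map_sum,
      map_sum, map_sum]
    refine Finset.sum_congr rfl fun j hj => ?_
    exact hE j (Finset.mem_range.1 hj) _ (cyclicEigenProjector_mem_eigenspace hτ hζ.pow_eq_one hζ0 j x)
  -- descend along the injection `v ↦ 1 ⊗ v`
  refine LinearMap.ext fun v => tmul_one_injective (V := V) ?_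
  have h1 := congrArg (fun u => u ((1 : ℂ) ⊗ₜ[ℚ] v)) hC
  simp only [LinearMap.coe_comp, Function.comp_apply, LinearMap.baseChange_tmul] at h1
  simpa only [LinearMap.coe_comp, Function.comp_apply] using h1

/-- **The degenerate branch of the Goursat–Kolchin–Ribet assembly, in the consumer's shape**: under the
hypotheses of `commute_of_finrank_eigenspace_le_one`, the commutator `g h g⁻¹ h⁻¹` of two `τ`-commuting
automorphisms is `1` (hence lies in every `glIdentityComponent`). [cite: CarlsonToledo1999, §2 (p. 5)] -/
theorem commutator_eq_one_of_finrank_eigenspace_le_one {τ : V →ₗ[ℚ] V} {p : ℕ} (hp : p.Prime) (hτ : τ ^ p = 1)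
    {ζ : ℂ} (hζ : IsPrimitiveRoot ζ p) (hfix : finrank ℚ (Module.End.eigenspace τ 1) ≤ 1) {j₀ : ℕ}
    (hj₀ : 1 ≤ j₀) (hj₀p : j₀ < p) (hsmall : finrank ℂ (Module.End.eigenspace (τ.baseChange ℂ) (ζ ^ j₀)) ≤ 1)
    {g h : V ≃ₗ[ℚ] V} (hg : ∀ x, g (τ x) = τ (g x)) (hh : ∀ x, h (τ x) = τ (h x)) :
    g * h * g⁻¹ * h⁻¹ = 1 := by
  have hc := commute_of_finrank_eigenspace_le_one hp hτ hζ hfix hj₀ hj₀p hsmall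
    (g := (g : V →ₗ[ℚ] V)) (h := (h : V →ₗ[ℚ] V)) (LinearMap.ext fun x => hg x) (LinearMap.ext fun x => hh x)
  have hgh : g * h = h * g :=
    LinearEquiv.toLinearMap_injective (by rw [LinearEquiv.coe_toLinearMap_mul, LinearEquiv.coe_toLinearMap_mul]; exact hc)
  rw [hgh, mul_inv_cancel_right, mul_inv_cancel]

end Literature.AlgebraicGeometry.HodgeTheory

end
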